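import Summits.QuantumAdvantage.QuantumAdvantage.Theorems.SosSandwichPseudoBoundedAAClassicalCornerNonadaptive
import HarnessLib

/-!
# Crux `PseudoBoundedAA` (stmt-QuantumAdvantage-15237, route SosSandwich) — the `L²`-OSSS law on the nonadaptive
# classical corner: `16 · Var[p]² ≤ Σⱼ δ̄ⱼ · Infⱼ[p]`

Support file for the rank-2 crux PB-AA (`Theses/SosSandwich.lean`, item stmt-QuantumAdvantage-15237), refining
`ClassicalCornerNonadaptive.exists_influence_ge_of_juntaMixture` (`16·Var² ≤ T·maxInf` for mixtures of `[0,1]`-valued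
`≤ T`-juntas).  For a mixture `p = Σ_{k∈s} w_k G_k` (`w_k ≥ 0`, `Σ w_k ≤ 1`, `0 ≤ G_k ≤ 1`, `G_k` an `S_k`-junta — no bound
on `|S_k|` is needed) we prove the OSSS-SHAPED `L²` law

  `16 · Var[p]² ≤ Σ_k w_k Σ_{i∈S_k} Infᵢ[p] = Σᵢ δ̄ᵢ · Infᵢ[p]`,  `δ̄ᵢ := Σ_{k : i ∈ S_k} w_k`

(`sixteen_variance_sq_le_sum_weight_influence`): the `L²`-influence analogue, for ACCEPTANCE PROBABILITIES of randomized
nonadaptive algorithms, of O'Donnell–Saks–Schramm–Servedio's `Var[f] ≤ Σᵢ δᵢ Infᵢ[f]` (`δ̄ᵢ` = probability that the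
algorithm reads `i`), with `Var` SQUARED as forced by the one-query mean (`p = (1/N)Σ xᵢ`: `16Var² = 1/N² = Σᵢ δ̄ᵢ Infᵢ`,
equality).  Since `Σᵢ δ̄ᵢ ≤ max_k |S_k|`, it implies the `T·maxInf` law (`exists_influence_ge_of_juntaMixture'`).

Why it is recorded: the same inequality `16·Var[p]² ≤ Σⱼ δ̄ⱼ·Infⱼ[p]` also holds on the block-product corner
(`ClassicalCornerBlockProduct`, via OSSS per block) and at `T = 1`, and is the natural depth-free statement whose validity on
all of `R_T` (randomized ADAPTIVE decision trees) would give the open `(2,1)` calibration `16Var² ≤ C·T·maxInf` of the classical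
corner; numerically its best constant on small adaptive mixtures exceeds `1` (`9/8` at `T = 2`), so on `R_T` it can only
hold with a constant `C > 1` — see the hand's evidence memo.

Proof (Walsh basis): `Var[p] = Σ_k w_k Σ_{∅≠U⊆S_k} p̂(U)Ĝ_k(U) ≤ ½ Σ_k w_k a_k` with `a_k² = Σ_{∅≠U⊆S_k} p̂(U)² ≤ ¼Σ_{i∈S_k}Infᵢ`
(as in the companion file), then Cauchy–Schwarz in `k` with the weights `w_k`: `(Σ w_k a_k)² ≤ (Σ w_k)(Σ w_k a_k²)`.

Honest label: an elementary Fourier inequality on a sub-corner of the classical corner of an open conjecture; no stub, crux or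
summit is closed.  Sources: R. O'Donnell, M. Saks, O. Schramm, R. Servedio, FOCS 2005, Thm 1.1; R. O'Donnell, *Analysis of
Boolean Functions* (CUP 2014) §1.4, §2.2, §8.6; S. Aaronson, A. Ambainis, arXiv:0911.0996, Conj. 6 / Thm 8.
-/

set_option linter.dupNamespace false

noncomputable section

namespace Summit.QuantumAdvantage.QuantumAdvantage.Theorems.SosSandwich

open Finset Function
open Literature.Computability.Complexity Literature.Computability.QuantumComplexity
open Literature.Computability.Complexity.LowDegree (cubeFourierCoeff)

namespace ClassicalCornerNonadaptive

variable {N : ℕ}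

/-- **`L²`-OSSS on the nonadaptive corner: `16 · Var[p]² ≤ Σ_k w_k Σ_{i∈S_k} Infᵢ[p]`.**  For a mixture
`p = Σ_{k∈s} w_k G_k` of `[0,1]`-valued `S_k`-juntas (`w_k ≥ 0`, `Σ w_k ≤ 1`; no bound on `|S_k|`),
`16 · Var[p]² ≤ Σᵢ δ̄ᵢ Infᵢ[p]` with `δ̄ᵢ = Σ_{k : i∈S_k} w_k` the probability that coordinate `i` is read.  Equality for the
one-query mean. [cite: OdonnellEtAl2005, Thm 1.1] [cite: ODonnell2014, §1.4, §2.2] [cite: AaronsonAmbainis2014, Conj. 6 / Thm 8] -/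
theorem sixteen_variance_sq_le_sum_weight_influence {ι : Type*} (s : Finset ι) (w : ι → ℝ) (hw : ∀ k ∈ s, 0 ≤ w k)
    (hw1 : ∑ k ∈ s, w k ≤ 1) (S : ι → Finset (Fin N))
    (G : ι → (Fin N → Bool) → ℝ) (hG01 : ∀ k ∈ s, ∀ x, 0 ≤ G k x ∧ G k x ≤ 1)
    (hGdep : ∀ k ∈ s, ∀ x y : Fin N → Bool, (∀ i ∈ S k, x i = y i) → G k x = G k y)
    (p : MvPolynomial (Fin N) ℝ) (hp : ∀ x, evalBool p x = ∑ k ∈ s, w k * G k x) :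
    16 * boolVariance p ^ 2 ≤ ∑ k ∈ s, w k * ∑ i ∈ S k, influence i p := by
  classical
  -- the Walsh-side quantities `a_k² = Σ_{∅≠U⊆S_k} p̂(U)²`
  set A : ι → ℝ := fun k => ∑ U ∈ (Finset.univ.filter (fun U : Finset (Fin N) => 1 ≤ U.card)).filter
      (fun U => U ⊆ S k), cubeFourierCoeff (evalBool p) U ^ 2 with hAdef
  have hA0 : ∀ k, 0 ≤ A k := fun k => Finset.sum_nonneg fun U _ => sq_nonneg _
  have hAle : ∀ k, A k ≤ (∑ i ∈ S k, influence i p) / 4 := fun k => sum_sq_cubeFourierCoeff_subset_le p (S k)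
  -- (1) the variance in the Walsh basis, expanded along the mixture
  have hvar : boolVariance p = ∑ U ∈ Finset.univ.filter (fun U : Finset (Fin N) => 1 ≤ U.card),
      cubeFourierCoeff (evalBool p) U ^ 2 := by
    rw [boolVariance_eq_tailWeight_one]
    rfl
  have hlin : ∀ U, cubeFourierCoeff (evalBool p) U = ∑ k ∈ s, w k * cubeFourierCoeff (G k) U :=
    cubeFourierCoeff_mixture s w G (evalBool p) hp
  have hexp : ∑ U ∈ Finset.univ.filter (fun U : Finset (Fin N) => 1 ≤ U.card), cubeFourierCoeff (evalBool p) U ^ 2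
      = ∑ k ∈ s, w k * ∑ U ∈ Finset.univ.filter (fun U : Finset (Fin N) => 1 ≤ U.card),
          cubeFourierCoeff (evalBool p) U * cubeFourierCoeff (G k) U := by
    calc ∑ U ∈ Finset.univ.filter (fun U : Finset (Fin N) => 1 ≤ U.card), cubeFourierCoeff (evalBool p) U ^ 2
        = ∑ U ∈ Finset.univ.filter (fun U : Finset (Fin N) => 1 ≤ U.card),
            ∑ k ∈ s, w k * (cubeFourierCoeff (evalBool p) U * cubeFourierCoeff (G k) U) := by
          refine Finset.sum_congr rfl fun U _ => ?_
          calc cubeFourierCoeff (evalBool p) U ^ 2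
              = cubeFourierCoeff (evalBool p) U * ∑ k ∈ s, w k * cubeFourierCoeff (G k) U := by
                rw [← hlin U, sq]
            _ = ∑ k ∈ s, w k * (cubeFourierCoeff (evalBool p) U * cubeFourierCoeff (G k) U) := by
                rw [Finset.mul_sum]
                exact Finset.sum_congr rfl fun k _ => by ring
      _ = ∑ k ∈ s, ∑ U ∈ Finset.univ.filter (fun U : Finset (Fin N) => 1 ≤ U.card),
            w k * (cubeFourierCoeff (evalBool p) U * cubeFourierCoeff (G k) U) := Finset.sum_comm
      _ = _ := Finset.sum_congr rfl fun k _ => by rw [Finset.mul_sum]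
  -- (2) per component: `Σ_U p̂ Ĝ_k ≤ √(A_k) / 2`
  have hk : ∀ k ∈ s, ∑ U ∈ Finset.univ.filter (fun U : Finset (Fin N) => 1 ≤ U.card),
      cubeFourierCoeff (evalBool p) U * cubeFourierCoeff (G k) U ≤ Real.sqrt (A k) * (1 / 2) := by
    intro k hk
    have hrestr : ∑ U ∈ (Finset.univ.filter (fun U : Finset (Fin N) => 1 ≤ U.card)).filter (fun U => U ⊆ S k),
          cubeFourierCoeff (evalBool p) U * cubeFourierCoeff (G k) U
        = ∑ U ∈ Finset.univ.filter (fun U : Finset (Fin N) => 1 ≤ U.card),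
          cubeFourierCoeff (evalBool p) U * cubeFourierCoeff (G k) U := by
      rw [Finset.sum_filter]
      refine Finset.sum_congr rfl fun U _ => ?_
      split_ifs with h
      · rfl
      · rw [cubeFourierCoeff_eq_zero_of_junta (G k) (S k) (hGdep k hk) U h, mul_zero]
    rw [← hrestr]
    have hcs := Finset.sum_mul_sq_le_sq_mul_sq
      ((Finset.univ.filter (fun U : Finset (Fin N) => 1 ≤ U.card)).filter (fun U => U ⊆ S k))
      (fun U => cubeFourierCoeff (evalBool p) U) (fun U => cubeFourierCoeff (G k) U)
    have h2 : ∑ U ∈ (Finset.univ.filter (fun U : Finset (Fin N) => 1 ≤ U.card)).filter (fun U => U ⊆ S k),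
        cubeFourierCoeff (G k) U ^ 2 ≤ 1 / 4 :=
      (Finset.sum_le_sum_of_subset_of_nonneg (Finset.filter_subset _ _) (fun U _ _ => sq_nonneg _)).trans
        (sum_sq_cubeFourierCoeff_nonempty_le_quarter (G k) (hG01 k hk))
    have h1nn : 0 ≤ ∑ U ∈ (Finset.univ.filter (fun U : Finset (Fin N) => 1 ≤ U.card)).filter (fun U => U ⊆ S k),
        cubeFourierCoeff (G k) U ^ 2 := Finset.sum_nonneg fun U _ => sq_nonneg _
    have hquarter : Real.sqrt (1 / 4 : ℝ) = 1 / 2 := by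
      rw [show (1 / 4 : ℝ) = (1 / 2) ^ 2 by norm_num, Real.sqrt_sq (by norm_num)]
    calc ∑ U ∈ (Finset.univ.filter (fun U : Finset (Fin N) => 1 ≤ U.card)).filter (fun U => U ⊆ S k),
          cubeFourierCoeff (evalBool p) U * cubeFourierCoeff (G k) U
        ≤ Real.sqrt (A k *
            ∑ U ∈ (Finset.univ.filter (fun U : Finset (Fin N) => 1 ≤ U.card)).filter (fun U => U ⊆ S k),
              cubeFourierCoeff (G k) U ^ 2) := Real.le_sqrt_of_sq_le hcs
      _ ≤ Real.sqrt (A k * (1 / 4)) := Real.sqrt_le_sqrt (mul_le_mul_of_nonneg_left h2 (hA0 k))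
      _ = Real.sqrt (A k) * (1 / 2) := by rw [Real.sqrt_mul (hA0 k), hquarter]
  -- (3) `2 · Var ≤ Σ_k w_k √(A_k)`
  have hvar_le : 2 * boolVariance p ≤ ∑ k ∈ s, w k * Real.sqrt (A k) := by
    have : boolVariance p ≤ ∑ k ∈ s, w k * (Real.sqrt (A k) * (1 / 2)) := by
      rw [hvar, hexp]
      exact Finset.sum_le_sum fun k hk' => mul_le_mul_of_nonneg_left (hk k hk') (hw k hk')
    have h2 : ∑ k ∈ s, w k * (Real.sqrt (A k) * (1 / 2)) = (∑ k ∈ s, w k * Real.sqrt (A k)) / 2 := by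
      rw [Finset.sum_div]
      exact Finset.sum_congr rfl fun k _ => by ring
    rw [h2] at this
    linarith
  -- (4) Cauchy–Schwarz in `k` with the weights: `(Σ w_k √A_k)² ≤ (Σ w_k)(Σ w_k A_k) ≤ Σ w_k A_k`
  have hcs : (∑ k ∈ s, w k * Real.sqrt (A k)) ^ 2 ≤ (∑ k ∈ s, w k) * ∑ k ∈ s, w k * A k := by
    have h := Finset.sum_mul_sq_le_sq_mul_sq s (fun k => Real.sqrt (w k)) (fun k => Real.sqrt (w k) * Real.sqrt (A k))
    have hl : ∑ k ∈ s, Real.sqrt (w k) * (Real.sqrt (w k) * Real.sqrt (A k)) = ∑ k ∈ s, w k * Real.sqrt (A k) :=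
      Finset.sum_congr rfl fun k hk' => by
        rw [← mul_assoc, Real.mul_self_sqrt (hw k hk')]
    have hr1 : ∑ k ∈ s, Real.sqrt (w k) ^ 2 = ∑ k ∈ s, w k :=
      Finset.sum_congr rfl fun k hk' => Real.sq_sqrt (hw k hk')
    have hr2 : ∑ k ∈ s, (Real.sqrt (w k) * Real.sqrt (A k)) ^ 2 = ∑ k ∈ s, w k * A k :=
      Finset.sum_congr rfl fun k hk' => by
        rw [mul_pow, Real.sq_sqrt (hw k hk'), Real.sq_sqrt (hA0 k)]
    rw [hl, hr1, hr2] at h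
    exact h
  have hwA0 : 0 ≤ ∑ k ∈ s, w k * A k := Finset.sum_nonneg fun k hk' => mul_nonneg (hw k hk') (hA0 k)
  have hsq : (∑ k ∈ s, w k * Real.sqrt (A k)) ^ 2 ≤ ∑ k ∈ s, w k * A k :=
    hcs.trans ((mul_le_mul_of_nonneg_right hw1 hwA0).trans_eq (one_mul _))
  -- (5) assemble
  have hv0 := boolVariance_nonneg p
  have hY0 : 0 ≤ ∑ k ∈ s, w k * Real.sqrt (A k) :=
    Finset.sum_nonneg fun k hk' => mul_nonneg (hw k hk') (Real.sqrt_nonneg _)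
  have h4 : 4 * boolVariance p ^ 2 ≤ ∑ k ∈ s, w k * A k := by
    calc 4 * boolVariance p ^ 2 = (2 * boolVariance p) ^ 2 := by ring
      _ ≤ (∑ k ∈ s, w k * Real.sqrt (A k)) ^ 2 := pow_le_pow_left₀ (by linarith) hvar_le 2
      _ ≤ ∑ k ∈ s, w k * A k := hsq
  have h5 : ∑ k ∈ s, w k * A k ≤ (∑ k ∈ s, w k * ∑ i ∈ S k, influence i p) / 4 := by
    rw [Finset.sum_div]
    refine Finset.sum_le_sum fun k hk' => ?_
    have h := mul_le_mul_of_nonneg_left (hAle k) (hw k hk')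
    calc w k * A k ≤ w k * ((∑ i ∈ S k, influence i p) / 4) := h
      _ = (w k * ∑ i ∈ S k, influence i p) / 4 := by ring
  linarith

/-- **Corollary: the `T · maxInf` form from the `L²`-OSSS form.**  If moreover `|S_k| ≤ T` and `M` dominates all influences,
`16 · Var[p]² ≤ T · M` (since `Σᵢ δ̄ᵢ Infᵢ ≤ Σ_k w_k · T · M ≤ T · M`); cf. `exists_influence_ge_of_juntaMixture`.
[cite: ODonnell2014, §1.4, §2.2] [cite: AaronsonAmbainis2014, Conj. 6 / Thm 8] -/
theorem sixteen_variance_sq_le_of_sum_weight_influence {ι : Type*} (s : Finset ι) (w : ι → ℝ) (hw : ∀ k ∈ s, 0 ≤ w k)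
    (hw1 : ∑ k ∈ s, w k ≤ 1) (S : ι → Finset (Fin N)) (T : ℕ) (hS : ∀ k ∈ s, (S k).card ≤ T)
    (G : ι → (Fin N → Bool) → ℝ) (hG01 : ∀ k ∈ s, ∀ x, 0 ≤ G k x ∧ G k x ≤ 1)
    (hGdep : ∀ k ∈ s, ∀ x y : Fin N → Bool, (∀ i ∈ S k, x i = y i) → G k x = G k y)
    (p : MvPolynomial (Fin N) ℝ) (hp : ∀ x, evalBool p x = ∑ k ∈ s, w k * G k x)
    (M : ℝ) (hM : ∀ i, influence i p ≤ M) (hM0 : 0 ≤ M) :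
    16 * boolVariance p ^ 2 ≤ (T : ℝ) * M := by
  have h := sixteen_variance_sq_le_sum_weight_influence s w hw hw1 S G hG01 hGdep p hp
  have hk : ∀ k ∈ s, w k * ∑ i ∈ S k, influence i p ≤ w k * ((T : ℝ) * M) := by
    intro k hk
    refine mul_le_mul_of_nonneg_left ?_ (hw k hk)
    calc ∑ i ∈ S k, influence i p ≤ ∑ _i ∈ S k, M := Finset.sum_le_sum fun i _ => hM i
      _ = ((S k).card : ℝ) * M := by rw [Finset.sum_const, nsmul_eq_mul]
      _ ≤ (T : ℝ) * M := mul_le_mul_of_nonneg_right (by exact_mod_cast hS k hk) hM0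
  have hTM : 0 ≤ (T : ℝ) * M := mul_nonneg (Nat.cast_nonneg _) hM0
  calc 16 * boolVariance p ^ 2 ≤ ∑ k ∈ s, w k * ∑ i ∈ S k, influence i p := h
    _ ≤ ∑ k ∈ s, w k * ((T : ℝ) * M) := Finset.sum_le_sum hk
    _ = (∑ k ∈ s, w k) * ((T : ℝ) * M) := by rw [Finset.sum_mul]
    _ ≤ 1 * ((T : ℝ) * M) := mul_le_mul_of_nonneg_right hw1 hTM
    _ = (T : ℝ) * M := one_mul _

end ClassicalCornerNonadaptive

end Summit.QuantumAdvantage.QuantumAdvantage.Theorems.SosSandwich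

end
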